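import Literature.NumberTheory.Transcendental.AnalytificationChartsProofs
import Literature.AlgebraicGeometry.HodgeTheory.HodgeSectionRestrictionTriangulable
import HarnessLib

/-!
# Affine charts of the complex points of a `ℂ`-scheme as real semialgebraic sets

Topic `Literature/AlgebraicGeometry/HodgeTheory` (semialgebraic geometry of `X(ℂ)`, as in
`HodgeSectionRestrictionTriangulable` for projective varieties). First file of the **semialgebraic
model of a compact neighbourhood of a Zariski-closed subset of `X(ℂ)`** for an ARBITRARY separated
`ℂ`-scheme locally of finite type (input (D2) of the retraction theorem
`SpecialisationMapRetraction.exists_homotopyEquiv_fiberToTube`: a compact neighbourhood of the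
special fibre is triangulated with the fibre as a subcomplex, by the tree's proved
`ModelTheory.ExponentialFields.semialgebraic_triangulation`).

Here: ONE affine chart. For `U ⊆ X` affine (`X` locally of finite type over `ℂ`) a finite
presentation `Γ(X, U) = ℂ[x₁, …, xₙ]/(F₁, …, F_m)` of the coordinate ring (Mathlib
`Algebra.Presentation.ofFinitePresentation`) gives coordinates
`c_U = (x₁, …, xₙ) : U(ℂ) → ℂⁿ` (`AffineChart`, `AffineChart.coord`) with:

* every regular function on `U` is a complex polynomial in the coordinates (`exists_poly`), so
  `c_U` is injective on `U(ℂ)` (`coord_injOn`) and a closed embedding of `U(ℂ)` (strong topology)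
  onto the algebraic set `V(F) ⊆ ℂⁿ` (`image_coord_eq`, `isClosedEmbedding_restrict_coord`;
  Serre, GAGA §2 n°5 Lemme 1 — the tree's `AlgPoints.isInducing_pi_eval`,
  `exists_evalOrZero_val_eq`); compact subsets of `ℂⁿ` pull back to compact subsets of `U(ℂ)`
  (`isCompact_setOf_coord_mem`);
* after realification `ℂⁿ = ℝ²ⁿ` (`ProjSemialg.realify`): `c_U(U(ℂ))` is `ℝ`-semialgebraic
  (`isSemialgebraic_image_coordR`), real and imaginary parts and `|s|²` of a regular function `s`
  are real polynomials in the real coordinates (`exists_re_im_poly_eval`);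
* a Zariski-closed `Z ⊆ X` is cut out on `U(ℂ)` by finitely many regular functions
  (`exists_finset_pt_mem_iff`, Noetherianity of `Γ(X, U)` and `V(I) ∩ U`), so
  `c_U(U(ℂ) ∩ Z(ℂ))` is semialgebraic (`isSemialgebraic_image_coordR_inter`);
* on an overlap with a second open `W`, a regular function on `W` is locally a FRACTION `g/fᵉ` of
  regular functions on `U` (`AlgPoints.exists_fraction`), recorded in the form used for the
  transition functions between charts (`exists_fraction_eval`).

Everything is proved; no named fact is introduced.

## References

* J.-P. Serre, *Géométrie algébrique et géométrie analytique*, Ann. Inst. Fourier 6 (1956), §2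
  n°5 Lemme 1. [SerreGAGA1956]
* J. Bochnak, M. Coste, M.-F. Roy, *Real Algebraic Geometry* (1998), Def. 2.1.4, Prop. 2.2.7,
  §3.4 (complex algebraic sets as real algebraic sets). [BochnakCosteRoy1998]
* D. Mumford, *The Red Book of Varieties and Schemes*, I §10. [MumfordRedBook1999]
-/

noncomputable section

open CategoryTheory AlgebraicGeometry Set MvPolynomial
open _root_.Topology
open Literature.AlgebraicGeometry.Motives
open Literature.AlgebraicGeometry.Motives.AlgPoints (evalOrZero evalOrZero_of_mem)
open Literature.ModelTheory.ExponentialFields (IsSemialgebraic)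
open Literature.NumberTheory.Transcendental

namespace Literature.AlgebraicGeometry.HodgeTheory

namespace SemialgModel

variable {X : SchemeOver ℂ}

/-! ### Affine charts with polynomial coordinates -/

/-- An **affine chart** of `X(ℂ)`: an affine open `U`, coordinates `x₁, …, xₙ ∈ Γ(X, U)` and
finitely many relations `F ∈ ℂ[X₁, …, Xₙ]`, such that every regular function on `U` is a polynomial
in the `xᵢ` on `U(ℂ)` and the coordinate image of `U(ℂ)` is the algebraic set `V(F)`.
[cite: SerreGAGA1956, §2 n°5 Lemme 1] -/
structure AffineChart (X : SchemeOver ℂ) where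
  /-- the affine open -/
  U : X.left.Opens
  /-- it is affine -/
  isAffineOpen : IsAffineOpen U
  /-- the number of coordinates -/
  n : ℕ
  /-- the coordinate functions -/
  x : Fin n → Γ(X.left, U)
  /-- the relations -/
  rel : Finset (MvPolynomial (Fin n) ℂ)
  /-- every regular function on `U` is a polynomial in the coordinates on `U(ℂ)` -/
  exists_poly' : ∀ s : Γ(X.left, U), ∃ p : MvPolynomial (Fin n) ℂ,
    ∀ (Q : ComplexPoints X) (hQ : Q.pt ∈ U),
      Q.eval U hQ s = MvPolynomial.eval (fun i => evalOrZero U (x i) Q) p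
  /-- the coordinate image of `U(ℂ)` is the zero set of the relations -/
  image_eq' : (fun (Q : ComplexPoints X) (i : Fin n) => evalOrZero U (x i) Q) '' {Q | Q.pt ∈ U} =
    {z | ∀ F ∈ rel, MvPolynomial.eval z F = 0}

namespace AffineChart

variable (C : AffineChart X)

/-- The complex coordinates `c_U : X(ℂ) → ℂⁿ` of the chart (`0` off `U(ℂ)`). [folklore] -/
def coord (Q : ComplexPoints X) : Fin C.n → ℂ := fun i => evalOrZero C.U (C.x i) Q

/-- The chart domain `U(ℂ) ⊆ X(ℂ)`. [folklore] -/
def dom : Set (ComplexPoints X) := {Q | Q.pt ∈ C.U}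

/-- Membership in the chart domain. [folklore] -/
@[simp] theorem mem_dom {Q : ComplexPoints X} : Q ∈ C.dom ↔ Q.pt ∈ C.U := Iff.rfl

/-- The chart domain is open. [folklore] -/
theorem isOpen_dom : IsOpen C.dom := AlgPoints.isOpen_setOf_pt_mem C.U

/-- Every regular function on `U` is a polynomial in the coordinates. [cite: SerreGAGA1956, §2 n°5] -/
theorem exists_poly (s : Γ(X.left, C.U)) : ∃ p : MvPolynomial (Fin C.n) ℂ,
    ∀ (Q : ComplexPoints X) (hQ : Q.pt ∈ C.U), Q.eval C.U hQ s = MvPolynomial.eval (C.coord Q) p :=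
  C.exists_poly' s

/-- The coordinate image of `U(ℂ)` is the algebraic set of the relations. [cite: SerreGAGA1956, §2 n°5 Lemme 1] -/
theorem image_coord_eq : C.coord '' C.dom = {z | ∀ F ∈ C.rel, MvPolynomial.eval z F = 0} :=
  C.image_eq'

/-- The coordinates are continuous on `U(ℂ)`. [cite: SerreGAGA1956, §2 n°5] -/
theorem continuousOn_coord : ContinuousOn C.coord C.dom :=
  AlgPoints.continuousOn_evalOrZero_pi C.x

/-- **The coordinates separate the points of `U(ℂ)`.** [cite: MumfordRedBook1999, I §10] -/
theorem coord_injOn : InjOn C.coord C.dom := by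
  intro Q hQ Q' hQ' h
  refine AlgPoints.ext_of_forall_eval_eq C.isAffineOpen hQ hQ' fun s => ?_
  obtain ⟨p, hp⟩ := C.exists_poly s
  rw [hp Q hQ, hp Q' hQ', h]

/-- The coordinate image of `U(ℂ)` is closed in `ℂⁿ`. [folklore] -/
theorem isClosed_image_coord : IsClosed (C.coord '' C.dom) := by
  rw [C.image_coord_eq]
  have : {z : Fin C.n → ℂ | ∀ F ∈ C.rel, MvPolynomial.eval z F = 0} =
      ⋂ F ∈ C.rel, {z | MvPolynomial.eval z F = 0} := by
    ext z; simp
  rw [this]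
  exact isClosed_biInter fun F _ => isClosed_eq (MvPolynomial.continuous_eval F) continuous_const

/-- **The strong topology of `U(ℂ)` is induced by the coordinates** (every regular function is a
polynomial in them, and `U(ℂ) → ℂ^{Γ(X,U)}` is inducing). [cite: SerreGAGA1956, §2 n°5 Lemme 1] -/
theorem isInducing_restrict_coord : IsInducing (C.dom.restrict C.coord) := by
  classical
  choose p hp using C.exists_poly
  let Φ : (Fin C.n → ℂ) → (Γ(X.left, C.U) → ℂ) := fun z s => MvPolynomial.eval z (p s)
  have hΦ : Continuous Φ := continuous_pi fun s => MvPolynomial.continuous_eval _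
  have hx : Continuous (C.dom.restrict C.coord) :=
    continuousOn_iff_continuous_restrict.mp C.continuousOn_coord
  have key : IsInducing fun (Q : C.dom) (s : Γ(X.left, C.U)) => Q.1.eval C.U Q.2 s :=
    AlgPoints.isInducing_pi_eval (L := ℂ) C.isAffineOpen
  have hcomp : Φ ∘ C.dom.restrict C.coord = fun (Q : C.dom) (s : Γ(X.left, C.U)) =>
      Q.1.eval C.U Q.2 s := by
    funext Q s
    exact (hp s Q.1 Q.2).symm
  exact IsInducing.of_comp hx hΦ (hcomp ▸ key)

/-- **`U(ℂ) → ℂⁿ` is a closed embedding onto `V(F)`.** [cite: SerreGAGA1956, §2 n°5 Lemme 1] -/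
theorem isClosedEmbedding_restrict_coord : IsClosedEmbedding (C.dom.restrict C.coord) := by
  refine ⟨⟨C.isInducing_restrict_coord, ?_⟩, ?_⟩
  · intro Q Q' h
    exact Subtype.ext (C.coord_injOn Q.2 Q'.2 h)
  · rw [Set.range_restrict]
    exact C.isClosed_image_coord

/-- **Compact subsets of `ℂⁿ` pull back to compact subsets of `U(ℂ)`** (closed in `X(ℂ)` when
`X(ℂ)` is Hausdorff). [folklore] -/
theorem isCompact_setOf_coord_mem {K : Set (Fin C.n → ℂ)} (hK : IsCompact K) :
    IsCompact {Q : ComplexPoints X | Q.pt ∈ C.U ∧ C.coord Q ∈ K} := by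
  have h1 : IsCompact ((C.dom.restrict C.coord) ⁻¹' K) :=
    C.isClosedEmbedding_restrict_coord.isCompact_preimage hK
  have h2 := h1.image continuous_subtype_val
  convert h2 using 1
  ext Q
  constructor
  · rintro ⟨hQ, hK'⟩
    exact ⟨⟨Q, hQ⟩, hK', rfl⟩
  · rintro ⟨Q', hQ', rfl⟩
    exact ⟨Q'.2, hQ'⟩

/-- Points of `V(F)` are coordinates of points of `U(ℂ)`. [cite: SerreGAGA1956, §2 n°5 Lemme 1] -/
theorem exists_coord_eq {z : Fin C.n → ℂ} (hz : ∀ F ∈ C.rel, MvPolynomial.eval z F = 0) :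
    ∃ Q : ComplexPoints X, Q.pt ∈ C.U ∧ C.coord Q = z := by
  have : z ∈ C.coord '' C.dom := by rw [C.image_coord_eq]; exact hz
  obtain ⟨Q, hQ, hQz⟩ := this
  exact ⟨Q, hQ, hQz⟩

/-- Coordinates of points of `U(ℂ)` satisfy the relations. [folklore] -/
theorem eval_rel_coord {Q : ComplexPoints X} (hQ : Q.pt ∈ C.U) {F : MvPolynomial (Fin C.n) ℂ}
    (hF : F ∈ C.rel) : MvPolynomial.eval (C.coord Q) F = 0 := by
  have : C.coord Q ∈ C.coord '' C.dom := ⟨Q, hQ, rfl⟩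
  rw [C.image_coord_eq] at this
  exact this F hF

/-! ### Construction from a finite presentation of `Γ(X, U)` -/

/-- **Every affine open of a `ℂ`-scheme locally of finite type carries an affine chart** (a finite
presentation of the finitely generated `ℂ`-algebra `Γ(X, U)`). [cite: SerreGAGA1956, §2 n°5 Lemme 1] -/
theorem exists_eq_U [LocallyOfFiniteType X.hom] {U : X.left.Opens} (hU : IsAffineOpen U) :
    ∃ C : AffineChart X, C.U = U := by
  classical
  letI alg : Algebra ℂ Γ(X.left, U) := (SchemeOver.scalarRingHom X U).toAlgebra
  have halg : ∀ c, algebraMap ℂ Γ(X.left, U) c = SchemeOver.scalarRingHom X U c := fun c => rfl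
  haveI : Algebra.FiniteType ℂ Γ(X.left, U) := by
    have h1 : (X.hom.appLE ⊤ U le_top).hom.FiniteType :=
      X.hom.finiteType_appLE (isAffineOpen_top _) hU le_top
    have h2 : (Scheme.ΓSpecIso (.of ℂ)).inv.hom.FiniteType :=
      RingHom.FiniteType.of_surjective _
        (Scheme.ΓSpecIso (.of ℂ)).symm.commRingCatIsoToRingEquiv.surjective
    exact h1.comp h2
  haveI : Algebra.FinitePresentation ℂ Γ(X.left, U) :=
    (Algebra.FinitePresentation.of_finiteType (R := ℂ) (A := Γ(X.left, U))).mp inferInstance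
  let P := Algebra.Presentation.ofFinitePresentation ℂ Γ(X.left, U)
  have hmap : ∀ F : MvPolynomial (Fin (Algebra.Presentation.ofFinitePresentationVars ℂ Γ(X.left, U))) ℂ,
      MvPolynomial.map (algebraMap ℂ ℂ) F = F := fun F => by
    rw [Algebra.algebraMap_self, MvPolynomial.map_id]
  have hpoly : ∀ s : Γ(X.left, U), ∃ p : MvPolynomial (Fin _) ℂ,
      ∀ (Q : ComplexPoints X) (hQ : Q.pt ∈ U),
        Q.eval U hQ s = MvPolynomial.eval (fun i => evalOrZero U (P.val i) Q) p := fun s => by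
    refine ⟨P.σ s, fun Q hQ => ?_⟩
    have h := AlgPoints.eval_eq_eval_map_σ (L := ℂ) halg P.toGenerators hQ s
    rw [hmap] at h
    exact h
  have himage : (fun (Q : ComplexPoints X) (i : Fin _) => evalOrZero U (P.val i) Q) '' {Q | Q.pt ∈ U} =
      {z | ∀ F ∈ (Finset.univ.image fun j => P.relation j), MvPolynomial.eval z F = 0} := by
    ext z
    simp only [Set.mem_image, Set.mem_setOf_eq, Finset.mem_image, Finset.mem_univ, true_and,
      forall_exists_index, forall_apply_eq_imp_iff]
    constructor
    · rintro ⟨Q, hQ, rfl⟩ j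
      have h := AlgPoints.eval_map_relation_eq_zero (L := ℂ) halg P hQ j
      rw [hmap] at h
      exact h
    · intro hz
      obtain ⟨Q, hQ, hQz⟩ := AlgPoints.exists_evalOrZero_val_eq (L := ℂ) halg hU P z fun j => by
        rw [hmap]; exact hz j
      exact ⟨Q, hQ, hQz⟩
  exact ⟨AffineChart.mk U hU _ P.val (Finset.univ.image fun j => P.relation j) hpoly himage, rfl⟩

/-! ### Real coordinates and semialgebraicity -/

/-- The real coordinates `ℝ²ⁿ`-valued: real and imaginary parts of the complex coordinates.
[folklore] -/
def coordR (Q : ComplexPoints X) : Fin (C.n + C.n) → ℝ := ProjSemialg.realify (C.coord Q)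

/-- `complexify ∘ coordR = coord`. [folklore] -/
@[simp] theorem complexify_coordR (Q : ComplexPoints X) :
    ProjSemialg.complexify (C.coordR Q) = C.coord Q :=
  ProjSemialg.complexify_realify _

/-- The real coordinates are continuous on `U(ℂ)`. [folklore] -/
theorem continuousOn_coordR : ContinuousOn C.coordR C.dom := by
  have hre : Continuous (ProjSemialg.realify : (Fin C.n → ℂ) → Fin (C.n + C.n) → ℝ) := by
    refine continuous_pi fun j => ?_
    refine Fin.addCases (fun i => ?_) (fun i => ?_) j
    · simp only [ProjSemialg.realify_castAdd]
      exact Complex.continuous_re.comp (continuous_apply i)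
    · simp only [ProjSemialg.realify_natAdd]
      exact Complex.continuous_im.comp (continuous_apply i)
  exact hre.comp_continuousOn C.continuousOn_coord

/-- The real coordinates separate the points of `U(ℂ)`. [folklore] -/
theorem coordR_injOn : InjOn C.coordR C.dom := fun Q hQ Q' hQ' h =>
  C.coord_injOn hQ hQ' (by rw [← C.complexify_coordR, ← C.complexify_coordR, h])

/-- The real coordinate image of `U(ℂ)`. [folklore] -/
theorem image_coordR_eq : C.coordR '' C.dom =
    {w | ∀ F ∈ C.rel, MvPolynomial.eval (ProjSemialg.complexify w) F = 0} := by
  ext w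
  constructor
  · rintro ⟨Q, hQ, rfl⟩ F hF
    rw [C.complexify_coordR]
    exact C.eval_rel_coord hQ hF
  · intro hw
    obtain ⟨Q, hQ, hQz⟩ := C.exists_coord_eq hw
    refine ⟨Q, hQ, ?_⟩
    rw [coordR, hQz, ProjSemialg.realify_complexify]

/-- **The real coordinate image of `U(ℂ)` is semialgebraic** (indeed real algebraic).
[cite: BochnakCosteRoy1998, Def. 2.1.4 and §3.4] -/
theorem isSemialgebraic_image_coordR : IsSemialgebraic ℝ (C.coordR '' C.dom) := by
  rw [C.image_coordR_eq]
  have : {w : Fin (C.n + C.n) → ℝ | ∀ F ∈ C.rel, MvPolynomial.eval (ProjSemialg.complexify w) F = 0} =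
      ⋂ F ∈ C.rel, {w | MvPolynomial.eval (ProjSemialg.complexify w) F = 0} := by
    ext w; simp
  rw [this]
  exact Literature.ModelTheory.ExponentialFields.IsSemialgebraic.biInter C.rel _ fun F _ =>
    ProjSemialg.isSemialgebraic_setOf_eval_complexify_eq_zero F

/-- **Real and imaginary parts of a regular function are real polynomials in the real
coordinates.** [cite: BochnakCosteRoy1998, §3.4] -/
theorem exists_re_im_poly_eval (s : Γ(X.left, C.U)) :
    ∃ P Q : MvPolynomial (Fin (C.n + C.n)) ℝ, ∀ (R : ComplexPoints X) (hR : R.pt ∈ C.U),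
      (R.eval C.U hR s).re = MvPolynomial.aeval (C.coordR R) P ∧
        (R.eval C.U hR s).im = MvPolynomial.aeval (C.coordR R) Q := by
  obtain ⟨p, hp⟩ := C.exists_poly s
  obtain ⟨P, Q, hPQ⟩ := ProjSemialg.exists_re_im_poly p
  refine ⟨P, Q, fun R hR => ?_⟩
  have h := hPQ (C.coordR R)
  rw [C.complexify_coordR, ← hp R hR] at h
  constructor
  · have := congrArg Complex.re h
    simpa using this
  · have := congrArg Complex.im h
    simpa using this

/-- **The squared modulus of a regular function is a real polynomial in the real coordinates.**
[cite: BochnakCosteRoy1998, §3.4] -/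
theorem exists_normSq_poly_eval (s : Γ(X.left, C.U)) :
    ∃ P : MvPolynomial (Fin (C.n + C.n)) ℝ, ∀ (R : ComplexPoints X) (hR : R.pt ∈ C.U),
      Complex.normSq (R.eval C.U hR s) = MvPolynomial.aeval (C.coordR R) P := by
  obtain ⟨P, Q, hPQ⟩ := C.exists_re_im_poly_eval s
  refine ⟨P ^ 2 + Q ^ 2, fun R hR => ?_⟩
  obtain ⟨h1, h2⟩ := hPQ R hR
  rw [Complex.normSq_apply, h1, h2]
  simp only [map_add, map_pow]
  ring

/-! ### Zariski-closed subsets in the chart -/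

/-- **A Zariski-closed subset is cut out on `U(ℂ)` by finitely many regular functions on `U`.**
(`Z ∩ U = V(I) ∩ U` for an ideal `I ⊆ Γ(X, U)`, finitely generated as `Γ(X, U)` is Noetherian; a
complex point of `U` lies in `V(g)` iff `g` vanishes at it.) [cite: MumfordRedBook1999, I §10] -/
theorem exists_finset_pt_mem_iff [LocallyOfFiniteType X.hom] {Z : Set X.left} (hZ : IsClosed Z) :
    ∃ G : Finset Γ(X.left, C.U), ∀ (Q : ComplexPoints X) (hQ : Q.pt ∈ C.U),
      Q.pt ∈ Z ↔ ∀ g ∈ G, Q.eval C.U hQ g = 0 := by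
  classical
  have hU := C.isAffineOpen
  -- `Γ(X, U)` is Noetherian
  letI alg : Algebra ℂ Γ(X.left, C.U) := (SchemeOver.scalarRingHom X C.U).toAlgebra
  haveI : Algebra.FiniteType ℂ Γ(X.left, C.U) := by
    have h1 : (X.hom.appLE ⊤ C.U le_top).hom.FiniteType :=
      X.hom.finiteType_appLE (isAffineOpen_top _) hU le_top
    have h2 : (Scheme.ΓSpecIso (.of ℂ)).inv.hom.FiniteType :=
      RingHom.FiniteType.of_surjective _
        (Scheme.ΓSpecIso (.of ℂ)).symm.commRingCatIsoToRingEquiv.surjective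
    exact h1.comp h2
  haveI : IsNoetherianRing Γ(X.left, C.U) := Algebra.FiniteType.isNoetherianRing ℂ _
  -- `Z ∩ U` pulled back to `Spec Γ(X, U)` is the zero locus of a finitely generated ideal
  have hcl : IsClosed (hU.fromSpec ⁻¹' Z) := hZ.preimage hU.fromSpec.continuous
  obtain ⟨I, hI⟩ := (PrimeSpectrum.isClosed_iff_zeroLocus_ideal _).mp hcl
  obtain ⟨G, hG⟩ : I.FG := IsNoetherian.noetherian I
  have hpre : hU.fromSpec ⁻¹' Z = PrimeSpectrum.zeroLocus (G : Set Γ(X.left, C.U)) := by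
    rw [hI, ← hG, PrimeSpectrum.zeroLocus_span]
  have hZU : Z ∩ (C.U : Set X.left) = X.left.zeroLocus (G : Set Γ(X.left, C.U)) ∩ C.U := by
    rw [← hU.fromSpec_image_zeroLocus, ← hpre, Set.image_preimage_eq_inter_range,
      hU.range_fromSpec]
  refine ⟨G, fun Q hQ => ?_⟩
  have key : Q.pt ∈ Z ↔ Q.pt ∈ X.left.zeroLocus (G : Set Γ(X.left, C.U)) := by
    constructor
    · intro h
      have : Q.pt ∈ Z ∩ (C.U : Set X.left) := ⟨h, hQ⟩
      rw [hZU] at this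
      exact this.1
    · intro h
      have : Q.pt ∈ X.left.zeroLocus (G : Set Γ(X.left, C.U)) ∩ C.U := ⟨h, hQ⟩
      rw [← hZU] at this
      exact this.1
  rw [key, Scheme.mem_zeroLocus_iff]
  refine forall₂_congr fun g _ => ?_
  rw [AlgPoints.pt_mem_basicOpen_iff Q hQ g, not_not]

/-- **The real coordinate image of `U(ℂ) ∩ Z(ℂ)` is semialgebraic** for `Z` Zariski-closed.
[cite: BochnakCosteRoy1998, §3.4] -/
theorem isSemialgebraic_image_coordR_inter [LocallyOfFiniteType X.hom] {Z : Set X.left}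
    (hZ : IsClosed Z) : IsSemialgebraic ℝ (C.coordR '' (C.dom ∩ {Q | Q.pt ∈ Z})) := by
  classical
  obtain ⟨G, hG⟩ := C.exists_finset_pt_mem_iff hZ
  -- real polynomials cutting out `Z` in the real coordinates
  choose P hP using fun g : Γ(X.left, C.U) => C.exists_normSq_poly_eval g
  have heq : C.coordR '' (C.dom ∩ {Q | Q.pt ∈ Z}) =
      C.coordR '' C.dom ∩ {w | ∀ g ∈ G, MvPolynomial.aeval w (P g) = 0} := by
    ext w
    constructor
    · rintro ⟨Q, ⟨hQ, hQZ⟩, rfl⟩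
      refine ⟨⟨Q, hQ, rfl⟩, fun g hg => ?_⟩
      rw [← hP g Q hQ, Complex.normSq_eq_zero]
      exact ((hG Q hQ).1 hQZ) g hg
    · rintro ⟨⟨Q, hQ, rfl⟩, hw⟩
      refine ⟨Q, ⟨hQ, (hG Q hQ).2 fun g hg => ?_⟩, rfl⟩
      rw [← Complex.normSq_eq_zero, hP g Q hQ]
      exact hw g hg
  rw [heq]
  refine C.isSemialgebraic_image_coordR.inter ?_
  have : {w : Fin (C.n + C.n) → ℝ | ∀ g ∈ G, MvPolynomial.aeval w (P g) = 0} =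
      ⋂ g ∈ G, {w | MvPolynomial.aeval w (P g) = 0} := by
    ext w; simp
  rw [this]
  exact Literature.ModelTheory.ExponentialFields.IsSemialgebraic.biInter G _ fun g _ =>
    Literature.ModelTheory.ExponentialFields.isSemialgebraic_setOf_eval_eq_zero (P g)

/-! ### Transition functions: regular functions on another open are fractions -/

/-- **Transition data.** For a regular function `s` on another open `W` and a point of `U ∩ W`,
there are `f, g ∈ Γ(X, U)`, `e : ℕ` and the basic open `D(f) ⊆ U ∩ W` containing the point, on
whose complex points `f ≠ 0` and `s = g / fᵉ`. [cite: SerreGAGA1956, §2 n°5 Lemme 1] -/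
theorem exists_fraction_eval {W : X.left.Opens} (s : Γ(X.left, W)) {x : X.left} (hxU : x ∈ C.U)
    (hxW : x ∈ W) :
    ∃ (f g : Γ(X.left, C.U)) (e : ℕ) (hle : X.left.basicOpen f ≤ W), x ∈ X.left.basicOpen f ∧
      ∀ (Q : ComplexPoints X) (hQ : Q.pt ∈ X.left.basicOpen f),
        Q.eval C.U (X.left.basicOpen_le f hQ) f ≠ 0 ∧
        Q.eval W (hle hQ) s =
          Q.eval C.U (X.left.basicOpen_le f hQ) g / Q.eval C.U (X.left.basicOpen_le f hQ) f ^ e := by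
  obtain ⟨f, g, e, hle, hxf, h⟩ := AlgPoints.exists_fraction (L := ℂ) C.isAffineOpen s hxU hxW
  refine ⟨f, g, e, hle, hxf, fun Q hQ => ?_⟩
  have hf : Q.eval C.U (X.left.basicOpen_le f hQ) f ≠ 0 :=
    (AlgPoints.pt_mem_basicOpen_iff Q (X.left.basicOpen_le f hQ) f).1 hQ
  refine ⟨hf, ?_⟩
  rw [eq_div_iff (pow_ne_zero e hf)]
  exact h Q hQ

end AffineChart

end SemialgModel

end Literature.AlgebraicGeometry.HodgeTheory

end
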